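import Mathlib.Combinatorics.SetFamily.Compression.Down
import Mathlib.Tactic
import HarnessLib
import HarnessLib.Audit.Tags
import Summits.CriticalPhenomena.PercolationContinuityZ3.Theorems.PercNearOneGluingNoHeavyLowerTailSahiRainbowTwoColourSmallThreeCases

/-!
# The two-colouring statement for THREE antipodal pairs (`#Z = 6`): assembly over the 64 colourings

Support file (seat `prim-masterthm-p1`, gen 42; `--supports stmt-CriticalPhenomena-4575`).  No `sorry`, standard axioms.

SETTING (`…SahiRainbowTwoColour`): `Z = X ⊔ Y ⊆ 2^G` complement-closed, `L = monoMeets X Y` (`∅` and the meets of distinct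
same-coloured members).  `SmallTwoColourMeets` (`…TwoColourTwinPoint`) is the two-colouring inequality `#Z ≤ 2 · #L` for
`#Z ∈ {6, 8}`; after `…TwoColourDeficitFinal` (`sparseTwinPoint`) it is ALL that the rainbow lemma `RainbowMeetCojoin` and the
three-family inequality M3♯ (`TwoColourMeets`) still rest on.

THIS FILE: `three_le_card_monoMeets_six` / `card_le_two_mul_card_monoMeets_six` — extract the three antipodal pairs from `#Z = 6`
and dispatch the 64 colourings to the case lemmas of `…TwoColourSmallThreeCases` (two constant pairs of one colour; one of each
colour and a split pair; one constant pair; none).  The case `#Z = 8` is the next target.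
HONEST FRAMING: unconditional elementary lemma. [this work]
-/

namespace Summit.CriticalPhenomena.PercolationContinuityZ3.Theorems.SahiColouredDaykin

open Finset
open scoped FinsetFamily

variable {α : Type*} [DecidableEq α]

section Small3

variable {X Y : Finset (Finset α)} {G : Finset α}

/-- **`#Z = 6 ⟹ 3 ≤ #monoMeets`**: the two-colouring inequality for three antipodal pairs, on every ground set. [this work] -/
theorem three_le_card_monoMeets_six (hZG : ∀ z ∈ X ∪ Y, z ⊆ G) (hcc : ∀ z ∈ X ∪ Y, G \ z ∈ X ∪ Y) (hXY : Disjoint X Y)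
    (h6 : #(X ∪ Y) = 6) : 3 ≤ #(monoMeets X Y) := by
  have hσσ : ∀ {z : Finset α}, z ∈ X ∪ Y → G \ (G \ z) = z := fun hz => Finset.sdiff_sdiff_eq_self (hZG _ hz)
  have hGne : G.Nonempty := by
    rw [nonempty_iff_ne_empty]; rintro rfl
    have hsub : X ∪ Y ⊆ {∅} := fun z hz => mem_singleton.2 (subset_empty.1 (hZG z hz))
    have := card_le_card hsub
    rw [card_singleton] at this; omega
  have hzσ : ∀ {z : Finset α}, z ∈ X ∪ Y → z ≠ G \ z := by
    intro z _ e
    obtain ⟨x, hx⟩ := hGne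
    by_cases hxz : x ∈ z
    · have h' := hxz; rw [e] at h'; exact (mem_sdiff.1 h').2 hxz
    · have h' : x ∈ G \ z := mem_sdiff.2 ⟨hx, hxz⟩
      rw [← e] at h'; exact hxz h'
  -- three antipodal pairs
  obtain ⟨a, haZ⟩ : (X ∪ Y).Nonempty := card_pos.1 (by omega)
  have haZ' : G \ a ∈ X ∪ Y := hcc _ haZ
  have haσ : a ≠ G \ a := hzσ haZ
  obtain ⟨b, hb⟩ : (((X ∪ Y).erase a).erase (G \ a)).Nonempty :=
    card_pos.1 (by rw [card_erase_of_mem (mem_erase.2 ⟨haσ.symm, haZ'⟩), card_erase_of_mem haZ]; omega)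
  simp only [mem_erase] at hb
  obtain ⟨hba', hba, hbZ⟩ := hb
  have hbZ' : G \ b ∈ X ∪ Y := hcc _ hbZ
  have hbσ : b ≠ G \ b := hzσ hbZ
  have hb'a : G \ b ≠ a := fun e => hba' (by rw [← hσσ hbZ, e])
  have hb'a' : G \ b ≠ G \ a := fun e => hba (by rw [← hσσ hbZ, e, hσσ haZ])
  obtain ⟨c, hc⟩ : (((((X ∪ Y).erase a).erase (G \ a)).erase b).erase (G \ b)).Nonempty :=
    card_pos.1 (by
      rw [card_erase_of_mem (mem_erase.2 ⟨hbσ.symm, mem_erase.2 ⟨hb'a', mem_erase.2 ⟨hb'a, hbZ'⟩⟩⟩),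
        card_erase_of_mem (mem_erase.2 ⟨hba', mem_erase.2 ⟨hba, hbZ⟩⟩),
        card_erase_of_mem (mem_erase.2 ⟨haσ.symm, haZ'⟩), card_erase_of_mem haZ]; omega)
  simp only [mem_erase] at hc
  obtain ⟨hcb', hcb, hca', hca, hcZ⟩ := hc
  have hcZ' : G \ c ∈ X ∪ Y := hcc _ hcZ
  have hcσ : c ≠ G \ c := hzσ hcZ
  have hc'a : G \ c ≠ a := fun e => hca' (by rw [← hσσ hcZ, e])
  have hc'a' : G \ c ≠ G \ a := fun e => hca (by rw [← hσσ hcZ, e, hσσ haZ])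
  have hc'b : G \ c ≠ b := fun e => hcb' (by rw [← hσσ hcZ, e])
  have hc'b' : G \ c ≠ G \ b := fun e => hcb (by rw [← hσσ hcZ, e, hσσ hbZ])
  have sa : a ⊆ G := hZG _ haZ
  have sb : b ⊆ G := hZG _ hbZ
  have sc : c ⊆ G := hZG _ hcZ
  have eaa := hσσ haZ
  have ebb := hσσ hbZ
  have ecc := hσσ hcZ
  -- the 64 colourings
  rcases mem_union.1 haZ with a0 | a0 <;> rcases mem_union.1 haZ' with a1 | a1 <;> rcases mem_union.1 hbZ with b0 | b0 <;>
    rcases mem_union.1 hbZ' with b1 | b1 <;> rcases mem_union.1 hcZ with c0 | c0 <;> rcases mem_union.1 hcZ' with c1 | c1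
  · exact three_le_quad a0 a1 b0 b1 sa sb hba.symm hb'a.symm
  · exact three_le_quad a0 a1 b0 b1 sa sb hba.symm hb'a.symm
  · exact three_le_quad a0 a1 b0 b1 sa sb hba.symm hb'a.symm
  · exact three_le_quad a0 a1 b0 b1 sa sb hba.symm hb'a.symm
  · exact three_le_quad a0 a1 c0 c1 sa sc hca.symm hc'a.symm
  · exact three_le_t1 hXY a0 a1 b0 b1 c0 c1 sa sb sc hba hba' hca hca' hcb.symm
  · exact three_le_t1 hXY a0 a1 b0 b1 c1 (by rw [ecc]; exact c0) sa sb sdiff_subset hba hba' hc'a hc'a' hc'b.symm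
  · exact three_le_t2 hXY a0 a1 c0 c1 b0 b1 sa sc sb hba hba' hcb'.symm hc'b'.symm
  · exact three_le_quad a0 a1 c0 c1 sa sc hca.symm hc'a.symm
  · exact three_le_t1 hXY a0 a1 b1 (by rw [ebb]; exact b0) c0 c1 sa sdiff_subset sc hb'a hb'a' hca hca' hcb'.symm
  · exact three_le_t1 hXY a0 a1 b1 (by rw [ebb]; exact b0) c1 (by rw [ecc]; exact c0) sa sdiff_subset sdiff_subset hb'a hb'a' hc'a hc'a' hc'b'.symm
  · exact three_le_t2 hXY a0 a1 c0 c1 b1 (by rw [ebb]; exact b0) sa sc sdiff_subset hb'a hb'a' (by rw [ebb]; exact hcb.symm) (by rw [ebb]; exact hc'b.symm)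
  · exact three_le_quad a0 a1 c0 c1 sa sc hca.symm hc'a.symm
  · exact three_le_t2 hXY a0 a1 b0 b1 c0 c1 sa sb sc hca hca' hc'b hc'b'
  · exact three_le_t2 hXY a0 a1 b0 b1 c1 (by rw [ecc]; exact c0) sa sb sdiff_subset hc'a hc'a' (by rw [ecc]; exact hcb) (by rw [ecc]; exact hcb')
  · exact three_le_quad' b0 b1 c0 c1 sb sc hcb.symm hc'b.symm
  · exact three_le_quad b0 b1 c0 c1 sb sc hcb.symm hc'b.symm
  · exact three_le_t1 hXY b0 b1 a0 a1 c0 c1 sb sa sc hba.symm hb'a.symm hcb hcb' hca.symm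
  · exact three_le_t1 hXY b0 b1 a0 a1 c1 (by rw [ecc]; exact c0) sb sa sdiff_subset hba.symm hb'a.symm hc'b hc'b' hc'a.symm
  · exact three_le_t2 hXY b0 b1 c0 c1 a0 a1 sb sc sa hba.symm hb'a.symm hca'.symm hc'a'.symm
  · exact three_le_t1 hXY c0 c1 a0 a1 b0 b1 sc sa sb hca.symm hc'a.symm hcb.symm hc'b.symm hba.symm
  · exact three_le_t0 hXY a0 b0 c0 a1 b1 c1 sa sb sc hba.symm hca.symm hcb.symm
  · exact three_le_t0 hXY a0 b0 c1 a1 b1 (by rw [ecc]; exact c0) sa sb sdiff_subset hba.symm hc'a.symm hc'b.symm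
  · exact three_le_t1' hXY c0 c1 a1 (by rw [eaa]; exact a0) b1 (by rw [ebb]; exact b0) sc sdiff_subset sdiff_subset hca'.symm hc'a'.symm hcb'.symm hc'b'.symm hb'a'.symm
  · exact three_le_t1 hXY c0 c1 a0 a1 b1 (by rw [ebb]; exact b0) sc sa sdiff_subset hca.symm hc'a.symm hcb'.symm hc'b'.symm hb'a.symm
  · exact three_le_t0 hXY a0 b1 c0 a1 (by rw [ebb]; exact b0) c1 sa sdiff_subset sc hb'a.symm hca.symm hcb'.symm
  · exact three_le_t0 hXY a0 b1 c1 a1 (by rw [ebb]; exact b0) (by rw [ecc]; exact c0) sa sdiff_subset sdiff_subset hb'a.symm hc'a.symm hc'b'.symm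
  · exact three_le_t1' hXY c0 c1 a1 (by rw [eaa]; exact a0) b0 b1 sc sdiff_subset sb hca'.symm hc'a'.symm hcb.symm hc'b.symm hba'.symm
  · exact three_le_t2 hXY c0 c1 b0 b1 a0 a1 sc sb sa hca.symm hc'a.symm hba'.symm hb'a'.symm
  · exact three_le_t1' hXY b0 b1 a1 (by rw [eaa]; exact a0) c1 (by rw [ecc]; exact c0) sb sdiff_subset sdiff_subset hba'.symm hb'a'.symm hc'b hc'b' hc'a'.symm
  · exact three_le_t1' hXY b0 b1 a1 (by rw [eaa]; exact a0) c0 c1 sb sdiff_subset sc hba'.symm hb'a'.symm hcb hcb' hca'.symm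
  · exact three_le_quad' b0 b1 c0 c1 sb sc hcb.symm hc'b.symm
  · exact three_le_quad b0 b1 c0 c1 sb sc hcb.symm hc'b.symm
  · exact three_le_t1 hXY b0 b1 a1 (by rw [eaa]; exact a0) c0 c1 sb sdiff_subset sc hba'.symm hb'a'.symm hcb hcb' hca'.symm
  · exact three_le_t1 hXY b0 b1 a1 (by rw [eaa]; exact a0) c1 (by rw [ecc]; exact c0) sb sdiff_subset sdiff_subset hba'.symm hb'a'.symm hc'b hc'b' hc'a'.symm
  · exact three_le_t2 hXY b0 b1 c0 c1 a1 (by rw [eaa]; exact a0) sb sc sdiff_subset hba'.symm hb'a'.symm (by rw [eaa]; exact hca.symm) (by rw [eaa]; exact hc'a.symm)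
  · exact three_le_t1 hXY c0 c1 a1 (by rw [eaa]; exact a0) b0 b1 sc sdiff_subset sb hca'.symm hc'a'.symm hcb.symm hc'b.symm hba'.symm
  · exact three_le_t0 hXY a1 b0 c0 (by rw [eaa]; exact a0) b1 c1 sdiff_subset sb sc hba'.symm hca'.symm hcb.symm
  · exact three_le_t0 hXY a1 b0 c1 (by rw [eaa]; exact a0) b1 (by rw [ecc]; exact c0) sdiff_subset sb sdiff_subset hba'.symm hc'a'.symm hc'b.symm
  · exact three_le_t1' hXY c0 c1 a0 a1 b1 (by rw [ebb]; exact b0) sc sa sdiff_subset hca.symm hc'a.symm hcb'.symm hc'b'.symm hb'a.symm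
  · exact three_le_t1 hXY c0 c1 a1 (by rw [eaa]; exact a0) b1 (by rw [ebb]; exact b0) sc sdiff_subset sdiff_subset hca'.symm hc'a'.symm hcb'.symm hc'b'.symm hb'a'.symm
  · exact three_le_t0 hXY a1 b1 c0 (by rw [eaa]; exact a0) (by rw [ebb]; exact b0) c1 sdiff_subset sdiff_subset sc hb'a'.symm hca'.symm hcb'.symm
  · exact three_le_t0 hXY a1 b1 c1 (by rw [eaa]; exact a0) (by rw [ebb]; exact b0) (by rw [ecc]; exact c0) sdiff_subset sdiff_subset sdiff_subset hb'a'.symm hc'a'.symm hc'b'.symm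
  · exact three_le_t1' hXY c0 c1 a0 a1 b0 b1 sc sa sb hca.symm hc'a.symm hcb.symm hc'b.symm hba.symm
  · exact three_le_t2 hXY c0 c1 b0 b1 a1 (by rw [eaa]; exact a0) sc sb sdiff_subset hca'.symm hc'a'.symm (by rw [eaa]; exact hba.symm) (by rw [eaa]; exact hb'a.symm)
  · exact three_le_t1' hXY b0 b1 a0 a1 c1 (by rw [ecc]; exact c0) sb sa sdiff_subset hba.symm hb'a.symm hc'b hc'b' hc'a.symm
  · exact three_le_t1' hXY b0 b1 a0 a1 c0 c1 sb sa sc hba.symm hb'a.symm hcb hcb' hca.symm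
  · exact three_le_quad' b0 b1 c0 c1 sb sc hcb.symm hc'b.symm
  · exact three_le_quad b0 b1 c0 c1 sb sc hcb.symm hc'b.symm
  · exact three_le_t2 hXY b0 b1 a0 a1 c0 c1 sb sa sc hcb hcb' hc'a hc'a'
  · exact three_le_t2 hXY b0 b1 a0 a1 c1 (by rw [ecc]; exact c0) sb sa sdiff_subset hc'b hc'b' (by rw [ecc]; exact hca) (by rw [ecc]; exact hca')
  · exact three_le_quad' a0 a1 c0 c1 sa sc hca.symm hc'a.symm
  · exact three_le_t2 hXY c0 c1 a0 a1 b0 b1 sc sa sb hcb.symm hc'b.symm hb'a hb'a'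
  · exact three_le_t1' hXY a0 a1 b1 (by rw [ebb]; exact b0) c1 (by rw [ecc]; exact c0) sa sdiff_subset sdiff_subset hb'a hb'a' hc'a hc'a' hc'b'.symm
  · exact three_le_t1' hXY a0 a1 b1 (by rw [ebb]; exact b0) c0 c1 sa sdiff_subset sc hb'a hb'a' hca hca' hcb'.symm
  · exact three_le_quad' a0 a1 c0 c1 sa sc hca.symm hc'a.symm
  · exact three_le_t2 hXY c0 c1 a0 a1 b1 (by rw [ebb]; exact b0) sc sa sdiff_subset hcb'.symm hc'b'.symm (by rw [ebb]; exact hba) (by rw [ebb]; exact hba')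
  · exact three_le_t1' hXY a0 a1 b0 b1 c1 (by rw [ecc]; exact c0) sa sb sdiff_subset hba hba' hc'a hc'a' hc'b.symm
  · exact three_le_t1' hXY a0 a1 b0 b1 c0 c1 sa sb sc hba hba' hca hca' hcb.symm
  · exact three_le_quad' a0 a1 c0 c1 sa sc hca.symm hc'a.symm
  · exact three_le_quad' a0 a1 b0 b1 sa sb hba.symm hb'a.symm
  · exact three_le_quad' a0 a1 b0 b1 sa sb hba.symm hb'a.symm
  · exact three_le_quad' a0 a1 b0 b1 sa sb hba.symm hb'a.symm
  · exact three_le_quad' a0 a1 b0 b1 sa sb hba.symm hb'a.symm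

/-- **The two-colouring inequality for three antipodal pairs**: `#Z = 6 ⟹ #Z ≤ 2 · #monoMeets`. [this work] -/
theorem card_le_two_mul_card_monoMeets_six (hZG : ∀ z ∈ X ∪ Y, z ⊆ G) (hcc : ∀ z ∈ X ∪ Y, G \ z ∈ X ∪ Y)
    (hXY : Disjoint X Y) (h6 : #(X ∪ Y) = 6) : #(X ∪ Y) ≤ 2 * #(monoMeets X Y) := by
  have := three_le_card_monoMeets_six hZG hcc hXY h6
  omega

end Small3

end Summit.CriticalPhenomena.PercolationContinuityZ3.Theorems.SahiColouredDaykin
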